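import Summits.BirchSwinnertonDyer.BirchSwinnertonDyer.Theorems.ResidualThetaTransportAtTwoSignedMuVanishingAtTwoPlusTrivialPlusSelmer
import HarnessLib

/-!
# Route `ResidualThetaTransportAtTwo`, crux Kμ⁺ `SignedMuVanishingAtTwoPlus` (stmt-BirchSwinnertonDyer-20689): the descent certificate
# in the UNIT-ANCHOR currency of cell `bsd-2adic` — `Sel⁺(A/ℚ_∞) = 0 ⟹ X⁺_A` finitely generated, torsion, `Char(X⁺_A) = Λ`, `μ = 0`

Sequel of `…TrivialPlusSelmer` (p588465, width seat `bsd-wall-rtt-p4-w2` g2). Route `ByReductionTypeAtTwo`'s unit-anchor road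
(`SSUnitAnchor.torsion_and_charIdeal_eq_top_and_mu_eq_zero_of_unitZone`, seat bsd-2adic-ss-1x) derives, for a unit-zone anchor `A`,
«`X⁺_A` f.g. ∧ torsion ∧ `Char = ⊤` ∧ `μ = 0`» from {modularity, GZK, `r_an(A) = 0`, the signed Euler characteristic (2′) at `A`,
`2 ∤ Tam(A)`, `2 ∤ #Ш(A)`}. THIS FILE gives the SAME conclusion shape from {HONDA⁺@2(A) (resp. INJ⁺@2(A)), `A.selmerGroupPInfty 2 = ⊥`,
`2 ∤ Tam(A)`} — no modularity, no GZK, no analytic rank, no Euler characteristic, no printed fact — through `X⁺_A = 0`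
(`subsingleton_X_of_signedSelmerInfty_eq_bot`). THEOREMS ONLY; `--supports` the crux; BSD is not proved by this.

References: [GreenbergLNM1716] §3 Prop. 3.8; [Kobayashi2003] Def. 1.1, §8.4, Thm. 9.3; [Washington1997] §13.2 (characteristic ideals).
-/

set_option autoImplicit false
set_option linter.dupNamespace false

noncomputable section

open scoped Classical NumberField

open NumberField IsDedekindDomain WeierstrassCurve Literature.NumberTheory.EllipticCurves
  Literature.NumberTheory.GaloisRepresentations ZpExtension Literature.NumberTheory.EllipticCurves.Kobayashi2003
  Literature.NumberTheory.EllipticCurves.IwasawaDual Literature.NumberTheory.EllipticCurves.IwasawaAlgebra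
  Literature.NumberTheory.EllipticCurves.Rank1Residual

universe u

namespace Summit.BirchSwinnertonDyer.BirchSwinnertonDyer.Theorems.SignedMuAtTwo

section General

variable {K : Type u} [Field K] [NumberField K] {W : WeierstrassCurve K} {p : ℕ} [Fact p.Prime]
  {κ : ZpExtension K p} {ε : ℤˣ}

/-- **`Sel^ε(E/K_∞) = 0 ⟹ Char(X^ε) = Λ`** for every Pontryagin-dual datum (`X^ε = 0`, every local length vanishes) — so Kobayashi's
main conjecture for such a datum says exactly that the signed `p`-adic `L`-function is a unit of `Λ`. [cite: Washington1997, §13.2]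
[cite: Kobayashi2003, Def. 1.1 and Thm. 1.2 (the object)] -/
theorem charIdeal_eq_top_of_signedSelmerInfty_eq_bot {γ : Field.absoluteGaloisGroup K} (D : SignedSelmerDualData W κ γ ε)
    (h : signedSelmerInfty W κ ε = ⊥) : D.charIdeal = ⊤ := by
  haveI := subsingleton_X_of_signedSelmerInfty_eq_bot D h
  show Literature.NumberTheory.EllipticCurves.Module.charIdeal (IwasawaAlgebra p) D.X = ⊤
  unfold Literature.NumberTheory.EllipticCurves.Module.charIdeal
  rw [← Ideal.one_eq_top]
  exact finprod_mem_of_eqOn_one fun 𝔭 _ ↦ by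
    rw [Module.lengthAt_eq_zero_of_subsingleton, ENat.toNat_zero, pow_zero]
    rfl

/-- **`Sel^ε(E/K_∞) = 0 ⟹` every nonzero-free datum: every `Λ`-submodule of `X^ε` is `⊥`** (in particular `X^ε` has no nonzero
finite submodule — B. D. Kim's property, trivially). [folklore] -/
theorem submodule_eq_bot_of_signedSelmerInfty_eq_bot {γ : Field.absoluteGaloisGroup K} (D : SignedSelmerDualData W κ γ ε)
    (h : signedSelmerInfty W κ ε = ⊥) (M : Submodule (IwasawaAlgebra p) D.X) : M = ⊥ := by
  haveI := subsingleton_X_of_signedSelmerInfty_eq_bot D h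
  exact Subsingleton.elim _ _

end General

section Two

variable (A : WeierstrassCurve ℚ) [A.IsElliptic] [A.IsGloballyMinimal]

/-- **THE UNIT-ANCHOR A-SIDE FROM THE DESCENT CERTIFICATE (INJ⁺ form)**: for `A/ℚ` globally minimal, good supersingular at `2`, with
INJ⁺@2 at every cyclotomic `κ`, `Sel_{2^∞}(A/ℚ) = 0` and `2 ∤ ∏c_ℓ(A)`: for every cyclotomic `κ`, topological generator `γ` and EVERY
Pontryagin-dual datum `D` of `Sel⁺(A/ℚ_∞)`, `X = D.X` is finitely generated, `Λ`-torsion, with `Char(X) = Λ` and `μ(X) = 0` — the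
conclusion shape of `SSUnitAnchor.torsion_and_charIdeal_eq_top_and_mu_eq_zero_of_unitZone`, reached with neither modularity nor GZK nor
the signed Euler characteristic. [cite: GreenbergLNM1716, §3 Prop. 3.8] [cite: Kobayashi2003, Thm. 9.3] -/
theorem finite_torsion_charIdeal_eq_top_mu_eq_zero_of_localInj_descentCertificate (hss : GoodSS A 2)
    (hinj : ∀ κ : ZpExtension ℚ 2, κ.IsCyclotomic → ∀ v : HeightOneSpectrum (𝓞 ℚ), (2 : 𝓞 ℚ) ∈ v.asIdeal →
      ∀ y ∈ (signedSelmerInfty A κ 1).comap (A.layerToInfty κ 0),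
        A.localResOver 2 (κ.layerSubgroup 0) (v.adicCompletion ℚ) y = 0)
    (hSel : A.selmerGroupPInfty 2 = ⊥) (hTam : ¬ 2 ∣ A.tamagawaProduct) :
    ∀ (κ : ZpExtension ℚ 2) (γ : Field.absoluteGaloisGroup ℚ), κ.IsCyclotomic → κ.IsTopGenerator γ →
      ∀ D : SignedSelmerDualData A κ γ 1, Module.Finite (IwasawaAlgebra 2) D.X ∧
        Module.IsTorsion (IwasawaAlgebra 2) D.X ∧ D.charIdeal = ⊤ ∧ D.mu = 0 := by
  intro κ γ hκ _hγ D
  have h := signedSelmerInfty_two_eq_bot_of_localInj A hss 1 hκ (hinj κ hκ) hSel hTam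
  haveI := moduleFinite_of_signedSelmerInfty_eq_bot D h
  exact ⟨inferInstance, isTorsion_of_signedSelmerInfty_eq_bot D h, charIdeal_eq_top_of_signedSelmerInfty_eq_bot D h,
    (isTorsion_and_mu_eq_zero_of_signedSelmerInfty_eq_bot D h).2⟩

/-- **THE UNIT-ANCHOR A-SIDE FROM THE DESCENT CERTIFICATE (HONDA form)**: as above with INJ⁺@2 discharged by a plus Honda system at
`2` for `A` (K4's registered stub `stub_plusHondaSystemTwo` read at `A`). Drop-in for the A-side binders {`hECA`, `hAr`, `hGZK`, `hSha`}
of `SSUnitAnchor.bsdp_two_of_unitAnchor`. [cite: Kobayashi2003, §8.4, Thm. 9.3] [cite: GreenbergLNM1716, §3 Prop. 3.8] -/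
theorem finite_torsion_charIdeal_eq_top_mu_eq_zero_of_honda_descentCertificate (hss : GoodSS A 2)
    (hHonda : ∀ κ : ZpExtension ℚ 2, κ.IsCyclotomic → ∀ (v : HeightOneSpectrum (𝓞 ℚ)), (2 : 𝓞 ℚ) ∈ v.asIdeal →
      ∃ d : ℕ → localPoints A (v.adicCompletion ℚ),
        (∀ m, d m ∈ localLayerPointsOfEmb κ (closureEmb (K := ℚ) (v.adicCompletion ℚ)) A m) ∧
        (∀ m, localTraceOfEmb κ (closureEmb (K := ℚ) (v.adicCompletion ℚ)) A (m + 1) (m + 2) (d (m + 2)) = -d m) ∧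
        (∀ m : ℕ, 1 ≤ m → ∀ P ∈ localLayerPointsOfEmb κ (closureEmb (K := ℚ) (v.adicCompletion ℚ)) A m,
          ∃ B ∈ AddSubgroup.closure (Set.range fun σ : Field.absoluteGaloisGroup (v.adicCompletion ℚ) ↦ σ • d m),
            ∃ P' ∈ localLayerPointsOfEmb κ (closureEmb (K := ℚ) (v.adicCompletion ℚ)) A (m - 1),
            ∃ R ∈ localLayerPointsOfEmb κ (closureEmb (K := ℚ) (v.adicCompletion ℚ)) A m, P = B + P' + 2 • R) ∧
        (∀ P ∈ localLayerPointsOfEmb κ (closureEmb (K := ℚ) (v.adicCompletion ℚ)) A 0,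
          ∃ a : ℤ, ∃ R ∈ localLayerPointsOfEmb κ (closureEmb (K := ℚ) (v.adicCompletion ℚ)) A 0, P = a • d 0 + 2 • R))
    (hSel : A.selmerGroupPInfty 2 = ⊥) (hTam : ¬ 2 ∣ A.tamagawaProduct) :
    ∀ (κ : ZpExtension ℚ 2) (γ : Field.absoluteGaloisGroup ℚ), κ.IsCyclotomic → κ.IsTopGenerator γ →
      ∀ D : SignedSelmerDualData A κ γ 1, Module.Finite (IwasawaAlgebra 2) D.X ∧
        Module.IsTorsion (IwasawaAlgebra 2) D.X ∧ D.charIdeal = ⊤ ∧ D.mu = 0 := by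
  intro κ γ hκ _hγ D
  have h := signedSelmerInfty_two_eq_bot_of_honda A hss hκ (hHonda κ hκ) hSel hTam
  haveI := moduleFinite_of_signedSelmerInfty_eq_bot D h
  exact ⟨inferInstance, isTorsion_of_signedSelmerInfty_eq_bot D h, charIdeal_eq_top_of_signedSelmerInfty_eq_bot D h,
    (isTorsion_and_mu_eq_zero_of_signedSelmerInfty_eq_bot D h).2⟩

end Two

end Summit.BirchSwinnertonDyer.BirchSwinnertonDyer.Theorems.SignedMuAtTwo

end
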